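import Summits.KontsevichZagierPeriods.Statement
import Summits.KontsevichZagierPeriods.KontsevichZagierPeriods.Theses.Neg

/-!
# KontsevichZagierPeriods / route Neg — the obstruction shape (item stmt-KontsevichZagierPeriods-0313)

Settles the support item `NegObstructionShape` of route Neg: the TEMPLATE any refutation of the
literal Kontsevich–Zagier statement must fit. If there is an additive invariant
`ι : KZ.FormalRep →+ A` (values in any abelian group `A`) vanishing on each of the four move sets
`domainAddRel`, `integrandAddRel`, `changeOfVariablesRel`, `newtonLeibnizRel`, together with two
representations `r`, `r'` of KZ's rational shape with the same value but `ι ([r] - [r']) ≠ 0`,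
then `KontsevichZagierPeriods` fails.

Proof: `KZ.relations` is by definition the `AddSubgroup.closure` of the union of the four move
sets, so `AddSubgroup.closure_le` gives `KZ.relations ≤ ι.ker` (`relations_le_ker_of_vanishes`);
the summit applied to `r`, `r'` gives `KZ.Equivalent r r'`, i.e. `[r] - [r'] ∈ KZ.relations`,
whence `ι ([r] - [r']) = 0`, a contradiction.

Sources: M. Kontsevich, D. Zagier, *Periods* (2001), §1.2 (the three rules and Conjecture 1).
Deliberately NOT here: any instance of such an invariant (that is crux #2 / #3 of the route).
-/

namespace Summit.KontsevichZagierPeriods.Neg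

open Literature.NumberTheory.Transcendental

/-- The universal property of the relation subgroup of the KZ calculus: an additive map out of
the formal group `KZ.FormalRep` that vanishes on every instance of the four moves (domain
additivity, integrand additivity, change of variables, Newton–Leibniz) vanishes on all of
`KZ.relations` (`= AddSubgroup.closure` of their union), by `AddSubgroup.closure_le`.
[Kontsevich–Zagier 2001, §1.2] [folklore] -/
theorem relations_le_ker_of_vanishes {A : Type*} [AddCommGroup A] (ι : KZ.FormalRep →+ A)
    (hι : ∀ c ∈ KZ.domainAddRel ∪ KZ.integrandAddRel ∪ KZ.changeOfVariablesRel ∪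
      KZ.newtonLeibnizRel, ι c = 0) :
    KZ.relations ≤ ι.ker := by
  unfold KZ.relations
  exact (AddSubgroup.closure_le _).mpr fun c hc => (AddMonoidHom.mem_ker).mpr (hι c hc)

/-- Settles item stmt-KontsevichZagierPeriods-0313 (`neg_obstruction_shape`), route Neg: the
route declaration `NegObstructionShape` holds — an additive invariant of `KZ.FormalRep` killing
the four move sets but separating two equal-valued rational-shape representations refutes
`KontsevichZagierPeriods`. The summit makes the two representations `KZ.Equivalent`, i.e.
`[r] - [r'] ∈ KZ.relations ≤ ι.ker` (`relations_le_ker_of_vanishes`), contradicting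
`ι ([r] - [r']) ≠ 0`. [Kontsevich–Zagier 2001, §1.2] [folklore] -/
theorem negObstructionShape_proof :
    Summit.KontsevichZagierPeriods.KontsevichZagierPeriods.Theses.Neg.NegObstructionShape := by
  unfold Summit.KontsevichZagierPeriods.KontsevichZagierPeriods.Theses.Neg.NegObstructionShape
  rintro ⟨A, _instA, ι, hι, n, m, r, r', hr, hr', hv, hne⟩ hS
  have hE : KZ.Equivalent r r' := hS r r' hr hr' hv
  exact hne ((AddMonoidHom.mem_ker).mp (relations_le_ker_of_vanishes ι hι hE))

end Summit.KontsevichZagierPeriods.Neg
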